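import Mathlib
import Summits.Langlands.Langlands.Theses.PicardMuOrdinary
import Literature.NumberTheory.GaloisRepresentations.GaloisRep
import Literature.NumberTheory.GaloisRepresentations.OrdinaryRegular
import Literature.NumberTheory.GaloisRepresentations.LocalClassFieldTheory
import Literature.NumberTheory.Automorphic.ReciprocityGLnProofs
import Literature.NumberTheory.GaloisRepresentations.PicardCurveGaloisRep
import Literature.NumberTheory.Automorphic.BaseChangeCyclicCuspidal
import Literature.NumberTheory.Automorphic.BaseChangeStrongUnramified
import Literature.NumberTheory.Automorphic.BaseChangeArchimedean
import Summits.Langlands.Langlands.Theorems.PicardMuOrdinaryIrregularClassicalityPlaceOfMaximalIdeal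
import Summits.Langlands.Langlands.Theorems.PicardMuOrdinaryIrregularClassicalityTwistedPicardGaloisInput
import Summits.Langlands.Langlands.Theorems.PicardMuOrdinaryIrregularClassicalityBaseChangeToL
import Summits.Langlands.Langlands.Theorems.PicardMuOrdinaryIrregularClassicalityBaseChangeToLLinked
import Summits.Langlands.Langlands.Theorems.PicardMuOrdinaryIrregularClassicalityIrregularDescentUntwist
import Summits.Langlands.Langlands.Theorems.PicardMuOrdinaryMuOrdinaryFamilyRTDictionary

/-!
# Line `split-ramified-prime-sqrt6` — the ORDINARY twisted-polarized restate of the crux, with a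
# kernel-checked certificate (continuation lead prover-line-stmt-Langlands-13758-c1-0, 2026-08-16)

Companion of `Lines/split_ramified_prime_sqrt6.lean` (reshape r5) and of lead-1's
`Lines/split_ramified_prime_sqrt6_restated.lean` (restate `IrregularClassicalityTwisted`).

WHY A SECOND RESTATE FILE.  Lead-1's restate repairs the CURRENCY of the 13757 → 13758 interface
(exactly conjugate-self-dual members congruent to the twisted traces `e(a_𝔭(f)·ϖ_𝔭)`), after which
the line is closed modulo named facts + ONE open theorem, the heart
`stub_twoWallOrdinaryClassicality`.  But the heart's intended proof (card K1–K3; BCGP 2025 §4 run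
with two walls on the `U(2,1)_{L/L⁺}` fourfold) consumes one more datum that the twisted-polarized
tower still forgets: an ORDINARY AVATAR of every member at `λ` — step (i) REALIZATION places the
eigensystem `λ'_{C,L}` in the μ-ordinary higher-Hida `H⁰` of the fourfold, which needs the `Π_k` to be
(μ-)ordinary at the places over `3`, i.e. their Galois representations `r_k` to be ORDINARY at `λ`
of some (regular, `k`-dependent) labelled weight.  A slope-free tower is consumed by NO classicality
mechanism in print or announced (Hida / higher Hida / Coleman / eigenvariety all start from a slope
datum at `p`); without the avatar the heart silently contains a second interface debt ("second half
of the interface debt", skeleton r5 docstring of Stub 5 (i); lead-0's promote-stub note; lead-1's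
restate-verdict "optional strengthening").  It is NOT optional: it is the difference between the
heart being BCGP's announced extension (ordinary input) and an `R = T`-cum-classicality statement
for an arbitrary `3`-adic limit of automorphic Galois representations.

WHAT THIS FILE CERTIFIES (no `sorry`):

1. `OrdTwistedPolarizedLimitHypothesis art f hcpt` — the interface in its final normal form:
   `ι`-currency (an isomorphism `ι : ℚ̄₃ ≃ ℂ` instead of a maximal ideal `𝔐 ∋ 3` of `ℤ̄`; the two
   currencies are interchangeable by the LANDED dictionaries `stub_placeOfMaximalIdeal` (13758, p78785)
   and `placeIdeal ι` / `exists_not_mem_and_mul_mem_span` (13757, `…MuOrdinaryFamilyRTDictionary`)),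
   members `Π_k` regular algebraic, EXACTLY conjugate self-dual, unramified and Galois-compatible off
   `S` with a representation `r_k : Γ_K → GL₃(ℚ̄₃)` that is ORDINARY AT `λ` of a dominant labelled
   weight (tree's `FramedGaloisRep.IsOrdinaryOfLabelledWeightAt`, relative to a local Artin datum
   `art` — a parameter, as everywhere in the tree), and `‖ι⁻¹(N𝔭·ΣSat(Π_k,𝔭) − e(a_𝔭(f)·ϖ_𝔭))‖ ≤ 3^{-k}`
   off `S` with `N𝔭·ΣSat ∈ e(a·ϖ) + ℤ̄` (integrality kept explicit, as in the filed typing).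
2. `IrregularClassicalityOrd` — the restated crux (`∀ art`), and
   `irregularClassicalityOrd_of_picardAutomorphy`: still a weakening of the target (no refutation room).
3. `ordHyp_twistedHyp` / `irregularClassicalityOrd_of_twisted`: the ordinary hypothesis implies
   lead-1's twisted-polarized hypothesis (drop the avatars, pass to the `𝔐`-currency by the 13757
   dictionary), so `IrregularClassicalityTwisted → IrregularClassicalityOrd`: the lattice is
   `X ⇒ IrregularClassicalityTwisted ⇒ IrregularClassicalityOrd`, each restate WEAKER as a claim and
   closer to what 13757's lines deliver (`R^{μ-ord} = T` outputs ordinary towers natively).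
4. `TwoWallOrdinaryClassicalityOrdStmt` — the heart with the avatars among its hypotheses (the
   registered heart verbatim plus the `K`-side ordinary avatar tower and `art`): the HONEST statement
   of BCGP's announced extension for this datum; and **`irregularClassicalityOrd_of` — THE
   CERTIFICATE**: the landed Stubs 2, 4, 6 + `primaryGen_unique` + the 13757 dictionary close
   `IrregularClassicalityOrd` modulo (a) `picardCurve_exists_lambdaAdicRep`, (b) the Arthur–Clozel
   TRIPLE (reshapes r8/r9 of lead c3, 2026-08-16: Stub 4 in LINKED form `stub_baseChangeToL_linked`
   base-changes every member WITH its `r_k`, so Harris–Lan–Taylor–Thorne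
   `exists_galoisRep_of_regularAlgebraic` is no longer a hypothesis of the certificate),
   (c) the LINKED heart `TwoWallOrdinaryClassicalityLinkedStmt` (r9; weaker than c1's
   `TwoWallOrdinaryClassicalityOrdStmt`, which implies it: `twoWallLinked_of_twoWallOrd`) — no
   interface stub, no remainder stub.

CONSEQUENCE FOR THE ROUTE (verdict file `restate-verdict-c1.md`): with the avatar in the interface,
13757's conclusion must produce ORDINARY towers, which is false on the λ-basic class (a `3`-adic limit
of ordinary representations of fixed residual type is ordinary — closed condition), so 13757 — hence
the route's `closes` — needs the Galois-side μ-ordinarity guard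
(`DrefuteG3_RepairGuard.MuOrdinaryGaloisGuard`) as a HYPOTHESIS and the basic class becomes a third,
separately filed crux; without the avatar the same basic class hides inside 13758's heart instead.
Either way it is crux-sized and has no mechanism in print; the guard only decides WHERE it is filed.
-/

open Literature.NumberTheory.GaloisRepresentations Literature.NumberTheory.Automorphic
open IsDedekindDomain NumberField Polynomial
open Summit.Langlands.Langlands.Cruxes.MuOrdinaryFamilyRT.CharZeroDominance
  (placeIdeal mem_placeIdeal placeIdeal_isMaximal three_mem_placeIdeal norm_eq_one_of_not_mem
    exists_not_mem_and_mul_mem_span norm_iotaInv_three_pow norm_iotaInv_le_one)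

set_option linter.dupNamespace false

noncomputable section

namespace Summit.Langlands.Langlands.Cruxes.IrregularClassicality.SplitRamifiedPrimeSqrt6.RestatedOrd

/-- A choice of local Artin datum at every finite place of `K = ℚ(ω)` (a parameter, as everywhere
in the tree: `LocalArtinData` is local class field theory's Artin map packaged as data; existence is
the discharged fact `nonempty_localArtinData_holds`). -/
abbrev ArtinData : Type :=
  ∀ v : HeightOneSpectrum (𝓞 (CyclotomicField 3 ℚ)), LocalArtinData (v.adicCompletion (CyclotomicField 3 ℚ))

/-- The conclusion of the crux at `f`, `hcpt` (VERBATIM the conclusion of `IrregularClassicality` and of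
the target `PicardAutomorphy`). -/
def AutomorphyConclusion (f : ℤ[X]) (hcpt : isCompact_glFiniteIntegralLevel 3 (CyclotomicField 3 ℚ)) :
    Prop :=
  ∃ (e : CyclotomicField 3 ℚ →+* ℂ) (π : CuspidalAutomorphicRepData 3 (CyclotomicField 3 ℚ) hcpt),
    π.1.IsLAlgebraic ∧
    ∀ᶠ 𝔭 : HeightOneSpectrum (𝓞 (CyclotomicField 3 ℚ)) in Filter.cofinite,
      ∃ α : Multiset ℂ, π.1.HasSatakeParamAt 𝔭 α ∧ α.sum = e (picardTrace f 𝔭)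

/-- Lead-1's / `Disproof.lean` §13 restated hypothesis (VERBATIM): the twisted-polarized tower in the
`𝔐`-currency, WITHOUT ordinary avatars. -/
def TwistedPolarizedLimitHypothesis (f : ℤ[X])
    (hcpt : isCompact_glFiniteIntegralLevel 3 (CyclotomicField 3 ℚ)) : Prop :=
  ∃ (e : CyclotomicField 3 ℚ →+* ℂ) (𝔐 : Ideal (integralClosure ℤ ℂ))
    (S : Finset (HeightOneSpectrum (𝓞 (CyclotomicField 3 ℚ))))
    (c₀ : CyclotomicField 3 ℚ ≃ₐ[ℚ] CyclotomicField 3 ℚ)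
    (ϖ : HeightOneSpectrum (𝓞 (CyclotomicField 3 ℚ)) → 𝓞 (CyclotomicField 3 ℚ)),
    𝔐.IsMaximal ∧ (3 : integralClosure ℤ ℂ) ∈ 𝔐 ∧ c₀ ≠ 1 ∧
    (∀ 𝔭 ∉ S, 𝔭.asIdeal = Ideal.span {ϖ 𝔭} ∧ ϖ 𝔭 - 1 ∈ Ideal.span {(3 : 𝓞 (CyclotomicField 3 ℚ))}) ∧
    ∀ k : ℕ, ∃ P : CuspidalAutomorphicRepData 3 (CyclotomicField 3 ℚ) hcpt, P.1.IsRegularAlgebraic ∧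
      P.1.IsConjSelfDualAE c₀ ∧
      ∀ 𝔭 ∉ S, ∃ (α : Multiset ℂ) (t u : integralClosure ℤ ℂ), P.1.HasSatakeParamAt 𝔭 α ∧
        (t : ℂ) = (𝔭.residueCard : ℂ) * α.sum - e (↑(picardTrace f 𝔭 * ϖ 𝔭)) ∧ u ∉ 𝔐 ∧
        u * t ∈ Ideal.span {(3 : integralClosure ℤ ℂ) ^ k}

/-- Lead-1's restated crux (VERBATIM). -/
def IrregularClassicalityTwisted : Prop :=
  ∀ (f : ℤ[X]) (hcpt : isCompact_glFiniteIntegralLevel 3 (CyclotomicField 3 ℚ)), f.natDegree = 4 →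
    (f.map (Int.castRingHom ℚ)).Separable → 12 ∣ Nat.card (f.map (Int.castRingHom ℚ)).Gal →
    TwistedPolarizedLimitHypothesis f hcpt → AutomorphyConclusion f hcpt

/-- **A `K`-side ORDINARY twisted-polarized tower** for the trace function `a` off `S`, read through
`ι` (the common shape of the restated hypothesis and of the heart's new input): for every depth `k` a
regular algebraic, exactly `c₀`-conjugate-self-dual cuspidal `Π` on `GL₃(𝔸_K)` with a Galois
representation `r : Γ_K → GL₃(ℚ̄₃)`, unramified and Galois-compatible off `S`
(`IsGaloisCompatibleAt`, HLTT normalisation `m = n = 3`), ORDINARY at every `v ∣ 3` of some dominant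
labelled weight relative to `art v`, and `‖ι⁻¹(N𝔭·ΣSat(Π,𝔭) − a 𝔭)‖ ≤ 3^{-k}` off `S` with
`N𝔭·ΣSat(Π,𝔭) − a 𝔭 ∈ ℤ̄`. -/
def OrdPolarizedTower (art : ArtinData) (hcpt : isCompact_glFiniteIntegralLevel 3 (CyclotomicField 3 ℚ))
    (ι : PadicAlgCl 3 ≃+* ℂ) (c₀ : CyclotomicField 3 ℚ ≃ₐ[ℚ] CyclotomicField 3 ℚ)
    (S : Finset (HeightOneSpectrum (𝓞 (CyclotomicField 3 ℚ))))
    (a : HeightOneSpectrum (𝓞 (CyclotomicField 3 ℚ)) → ℂ) : Prop :=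
  ∀ k : ℕ, ∃ (P : CuspidalAutomorphicRepData 3 (CyclotomicField 3 ℚ) hcpt)
    (r : FramedGaloisRep (CyclotomicField 3 ℚ) (PadicAlgCl 3) 3),
    P.1.IsRegularAlgebraic ∧ P.1.IsConjSelfDualAE c₀ ∧
    (∀ 𝔭 ∉ S, P.1.IsUnramifiedAt 𝔭 ∧ IsGaloisCompatibleAt P.1 ι r 𝔭 ∧
      ∃ (α : Multiset ℂ) (t : integralClosure ℤ ℂ), P.1.HasSatakeParamAt 𝔭 α ∧
        (t : ℂ) = (𝔭.residueCard : ℂ) * α.sum - a 𝔭 ∧ ‖ι.symm (t : ℂ)‖ ≤ ((3 : ℝ)⁻¹) ^ k) ∧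
    ∀ v : HeightOneSpectrum (𝓞 (CyclotomicField 3 ℚ)),
      ((3 : ℕ) : 𝓞 (CyclotomicField 3 ℚ)) ∈ v.asIdeal →
      ∃ wt : LabelledWeight (v.adicCompletion (CyclotomicField 3 ℚ)) (PadicAlgCl 3) 3,
        wt.IsDominant ∧ r.IsOrdinaryOfLabelledWeightAt v (art v) wt

/-- **The ORDINARY twisted-polarized limit hypothesis** (the 13757 → 13758 interface in final normal
form; `ι`-currency): an embedding `e`, an isomorphism `ι : ℚ̄₃ ≃ ℂ`, a finite `S`, complex conjugation
`c₀ ≠ 1`, primary generators `ϖ` off `S` (`𝔭 = (ϖ_𝔭)`, `ϖ_𝔭 ≡ 1 mod 3`; forces `λ ∈ S`), and an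
ordinary `c₀`-polarized tower for the twisted traces `e(a_𝔭(f)·ϖ_𝔭)` off `S`. -/
def OrdTwistedPolarizedLimitHypothesis (art : ArtinData) (f : ℤ[X])
    (hcpt : isCompact_glFiniteIntegralLevel 3 (CyclotomicField 3 ℚ)) : Prop :=
  ∃ (e : CyclotomicField 3 ℚ →+* ℂ) (ι : PadicAlgCl 3 ≃+* ℂ)
    (S : Finset (HeightOneSpectrum (𝓞 (CyclotomicField 3 ℚ))))
    (c₀ : CyclotomicField 3 ℚ ≃ₐ[ℚ] CyclotomicField 3 ℚ)
    (ϖ : HeightOneSpectrum (𝓞 (CyclotomicField 3 ℚ)) → 𝓞 (CyclotomicField 3 ℚ)),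
    c₀ ≠ 1 ∧
    (∀ 𝔭 ∉ S, 𝔭.asIdeal = Ideal.span {ϖ 𝔭} ∧ ϖ 𝔭 - 1 ∈ Ideal.span {(3 : 𝓞 (CyclotomicField 3 ℚ))}) ∧
    OrdPolarizedTower art hcpt ι c₀ S (fun 𝔭 => e (↑(picardTrace f 𝔭 * ϖ 𝔭)))

/-- **The restated crux `IrregularClassicalityᵒʳᵈ`**: for every choice of local Artin data and every
generic `f`, an ORDINARY twisted-polarized `3`-adic limit of regular algebraic cuspidal automorphic
representations attached to `ρ_C ⊗ ψ` implies automorphy of `C`. -/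
def IrregularClassicalityOrd : Prop :=
  ∀ (art : ArtinData) (f : ℤ[X]) (hcpt : isCompact_glFiniteIntegralLevel 3 (CyclotomicField 3 ℚ)),
    f.natDegree = 4 → (f.map (Int.castRingHom ℚ)).Separable →
    12 ∣ Nat.card (f.map (Int.castRingHom ℚ)).Gal →
    OrdTwistedPolarizedLimitHypothesis art f hcpt → AutomorphyConclusion f hcpt

/-- **No refutation room**: the ordinary restate is still implied by the target `PicardAutomorphy`
(only the hypothesis changed). [folklore] -/
theorem irregularClassicalityOrd_of_picardAutomorphy
    (hX : Summit.Langlands.Langlands.Theses.PicardMuOrdinary.PicardAutomorphy) :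
    IrregularClassicalityOrd :=
  fun _ f hcpt hdeg hsep hgal _ => hX f hcpt hdeg hsep hgal

/-! ## The two currencies: `ι`-adic norm bounds versus the place `𝔐 = placeIdeal ι` -/

/-- **`ι` is adapted to its own place ideal**: if `u ∉ 𝔐_ι` and `u·z ∈ 3^k ℤ̄` then `‖ι⁻¹ z‖ ≤ 3^{-k}`
(`‖ι⁻¹ u‖ = 1` off `𝔐_ι`, `‖ι⁻¹ s‖ ≤ 1` on `ℤ̄`, `‖ι⁻¹ 3^k‖ = 3^{-k}`). [folklore] -/
theorem adapted_placeIdeal (ι : PadicAlgCl 3 ≃+* ℂ) (z : integralClosure ℤ ℂ) (k : ℕ)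
    (h : ∃ u : integralClosure ℤ ℂ, u ∉ placeIdeal ι ∧
      u * z ∈ Ideal.span {(3 : integralClosure ℤ ℂ) ^ k}) :
    ‖ι.symm (z : ℂ)‖ ≤ ((3 : ℝ)⁻¹) ^ k := by
  obtain ⟨u, hu, huz⟩ := h
  obtain ⟨s, hs⟩ := Ideal.mem_span_singleton'.1 huz
  have h1 : ‖ι.symm ((u * z : integralClosure ℤ ℂ) : ℂ)‖ = ‖ι.symm (z : ℂ)‖ := by
    rw [Subalgebra.coe_mul, map_mul, norm_mul, norm_eq_one_of_not_mem ι hu, one_mul]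
  have h2 : ‖ι.symm ((u * z : integralClosure ℤ ℂ) : ℂ)‖ ≤ ((3 : ℝ)⁻¹) ^ k := by
    rw [← hs, Subalgebra.coe_mul, map_mul, norm_mul, norm_iotaInv_three_pow]
    calc ‖ι.symm (s : ℂ)‖ * ((3 : ℝ)⁻¹) ^ k ≤ 1 * ((3 : ℝ)⁻¹) ^ k := by
          gcongr; exact norm_iotaInv_le_one ι s
      _ = ((3 : ℝ)⁻¹) ^ k := one_mul _
  rw [← h1]; exact h2

/-- **From the norm bound to the `𝔐`-congruence**: `‖ι⁻¹ t‖ ≤ 3^{-k}` gives `u·t ∈ 3^k ℤ̄` for some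
`u ∉ 𝔐_ι` (13757 dictionary `exists_not_mem_and_mul_mem_span` with `b = 3^k`). [folklore] -/
theorem exists_unit_of_norm_le (ι : PadicAlgCl 3 ≃+* ℂ) (t : integralClosure ℤ ℂ) (k : ℕ)
    (h : ‖ι.symm (t : ℂ)‖ ≤ ((3 : ℝ)⁻¹) ^ k) :
    ∃ u : integralClosure ℤ ℂ, u ∉ placeIdeal ι ∧
      u * t ∈ Ideal.span {(3 : integralClosure ℤ ℂ) ^ k} := by
  refine exists_not_mem_and_mul_mem_span ι ?_ ?_
  · rw [Subalgebra.coe_pow]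
    exact pow_ne_zero _ (by norm_num)
  · rwa [norm_iotaInv_three_pow]

/-- **An ordinary tower in `ι`-currency is a polarized tower in the `𝔐_ι`-currency** (the input
shape of the landed Stub 4 `stub_baseChangeToL`), the avatars forgotten. [folklore] -/
theorem tower𝔐_of_ordPolarizedTower {art : ArtinData}
    {hcpt : isCompact_glFiniteIntegralLevel 3 (CyclotomicField 3 ℚ)} {ι : PadicAlgCl 3 ≃+* ℂ}
    {c₀ : CyclotomicField 3 ℚ ≃ₐ[ℚ] CyclotomicField 3 ℚ}
    {S : Finset (HeightOneSpectrum (𝓞 (CyclotomicField 3 ℚ)))}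
    {a : HeightOneSpectrum (𝓞 (CyclotomicField 3 ℚ)) → ℂ}
    (h : OrdPolarizedTower art hcpt ι c₀ S a) :
    ∀ k : ℕ, ∃ P : CuspidalAutomorphicRepData 3 (CyclotomicField 3 ℚ) hcpt,
      P.1.IsRegularAlgebraic ∧ P.1.IsConjSelfDualAE c₀ ∧
      ∀ 𝔭 ∉ S, ∃ (α : Multiset ℂ) (t u : integralClosure ℤ ℂ), P.1.HasSatakeParamAt 𝔭 α ∧
        (t : ℂ) = (𝔭.residueCard : ℂ) * α.sum - a 𝔭 ∧ u ∉ placeIdeal ι ∧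
        u * t ∈ Ideal.span {(3 : integralClosure ℤ ℂ) ^ k} := by
  intro k
  obtain ⟨P, r, hreg, hcsd, hP, -⟩ := h k
  refine ⟨P, hreg, hcsd, fun 𝔭 h𝔭 => ?_⟩
  obtain ⟨-, -, α, t, hα, ht, hnorm⟩ := hP 𝔭 h𝔭
  obtain ⟨u, hu, hut⟩ := exists_unit_of_norm_le ι t k hnorm
  exact ⟨α, t, u, hα, ht, hu, hut⟩

/-- **The ordinary hypothesis implies lead-1's twisted-polarized hypothesis** (take `𝔐 = 𝔐_ι`,
forget `ι`, the avatars and the Galois compatibility). [folklore] -/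
theorem ordHyp_twistedHyp {art : ArtinData} {f : ℤ[X]}
    {hcpt : isCompact_glFiniteIntegralLevel 3 (CyclotomicField 3 ℚ)}
    (h : OrdTwistedPolarizedLimitHypothesis art f hcpt) : TwistedPolarizedLimitHypothesis f hcpt := by
  obtain ⟨e, ι, S, c₀, ϖ, hc₀, hϖ, htower⟩ := h
  exact ⟨e, placeIdeal ι, S, c₀, ϖ, placeIdeal_isMaximal ι, three_mem_placeIdeal ι, hc₀, hϖ,
    tower𝔐_of_ordPolarizedTower htower⟩

/-- **The lattice of restates**: `IrregularClassicalityTwisted → IrregularClassicalityOrd` (so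
`X ⇒ Twisted ⇒ Ord`; each restate is a weaker claim, closer to what 13757 delivers). [folklore] -/
theorem irregularClassicalityOrd_of_twisted (h : IrregularClassicalityTwisted) :
    IrregularClassicalityOrd :=
  fun _ f hcpt hdeg hsep hgal hyp => h f hcpt hdeg hsep hgal (ordHyp_twistedHyp hyp)

/-! ## The heart with its ordinary avatars, and the certificate -/

/-- **The heart, honest form** (`stub_twoWallOrdinaryClassicality` of reshape r5 VERBATIM, plus two
hypotheses: the local Artin data `art` and the `K`-SIDE ORDINARY AVATAR TOWER off a finite `S_K` —
the input that step (i) REALIZATION of the intended proof consumes to place `λ'_{C,L}` in the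
μ-ordinary higher-Hida `H⁰` of the `U(2,1)_{L/L⁺}` fourfold).  For generic `f`, `ι, e`, `S₀ ⊇ {v ∣ 3}`,
primary generators `ϖ` off `S₀`, the twisted Picard representation `ρ = ρ_C ⊗ ψ` (unramified off `S₀`,
geometric-Frobenius trace `ι⁻¹ e(a_𝔭(f)·ϖ_𝔭)`), an ORDINARY `c₀`-polarized tower for these traces off
`S_K` (regular algebraic, exactly conjugate self-dual `Π_k`, Galois-compatible off `S_K` with an `r_k`
ordinary at `λ`, congruent to depth `k`), and over the CM field `L = K(√-2)` (involution `c`,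
`c|_K = c₀`) the Galois-convergent polarized tower of Stub 4: THEN `ρ` is automorphic over `K` — a
cuspidal `L`-algebraic `π'` on `GL₃(𝔸_K)` compatible with `ρ` almost everywhere
(`arithFrobPolyOfSatake ι q 1 α`).  Intended proof (i) realization in the μ-ordinary family of the
fourfold at tame level `S_L` (typicity via BCGP Lemma 276 / Prop. ES-semisimple), (ii) TWO-WALL
ORDINARY SEN = COUSIN for `Res_{K_λ/ℚ₃} GL₃`, `μ = ((1,0,0),(1,1,0))` — BCGP 2025's announced
extension to `p` not totally split (arXiv:2502.20645 p. 3), the load-bearing OPEN step —,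
(iii) multiplicity one, (iv) Mok transfer `U(2,1)_{L/L⁺} → GL₃/L` and signed descent `L → K`
(Goldring–Koskivirta pseudo-representation over `K` at a good auxiliary prime + Clifford).  TRUE
whatever the hypotheses (implied by reciprocity for `ρ'_C`); the hypotheses are what make (i)–(iv)
a proof STRATEGY.  This is the ONE open theorem of the line after the ordinary restate. -/
def TwoWallOrdinaryClassicalityOrdStmt : Prop :=
    ∀ (art : ArtinData) (f : ℤ[X]) (hcpt : isCompact_glFiniteIntegralLevel 3 (CyclotomicField 3 ℚ)),
      f.natDegree = 4 → (f.map (Int.castRingHom ℚ)).Separable →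
      12 ∣ Nat.card (f.map (Int.castRingHom ℚ)).Gal →
    ∀ (ι : PadicAlgCl 3 ≃+* ℂ) (e : CyclotomicField 3 ℚ →+* ℂ)
      (S₀ : Finset (HeightOneSpectrum (𝓞 (CyclotomicField 3 ℚ))))
      (ϖ : HeightOneSpectrum (𝓞 (CyclotomicField 3 ℚ)) → 𝓞 (CyclotomicField 3 ℚ))
      (ρ : FramedGaloisRep (CyclotomicField 3 ℚ) (PadicAlgCl 3) 3),
      (∀ v : HeightOneSpectrum (𝓞 (CyclotomicField 3 ℚ)),
        ((3 : ℕ) : 𝓞 (CyclotomicField 3 ℚ)) ∈ v.asIdeal → v ∈ S₀) →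
      (∀ 𝔭 ∉ S₀,
        (𝔭.asIdeal = Ideal.span {ϖ 𝔭} ∧
          ϖ 𝔭 - 1 ∈ Ideal.span {(3 : 𝓞 (CyclotomicField 3 ℚ))}) ∧
        ρ.IsUnramifiedAt 𝔭 ∧
        ∀ 𝔓 ∈ 𝔭.primesAbove, ∀ τ : Field.absoluteGaloisGroup (CyclotomicField 3 ℚ),
          IsArithFrobAt (𝓞 (CyclotomicField 3 ℚ)) τ 𝔓 →
            FramedRep.trace ρ τ⁻¹ = ι.symm (e (↑(picardTrace f 𝔭 * ϖ 𝔭)))) →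
    ∀ (c₀ : CyclotomicField 3 ℚ ≃ₐ[ℚ] CyclotomicField 3 ℚ)
      (S_K : Finset (HeightOneSpectrum (𝓞 (CyclotomicField 3 ℚ)))),
      OrdPolarizedTower art hcpt ι c₀ S_K (fun 𝔭 => e (↑(picardTrace f 𝔭 * ϖ 𝔭))) →
    ∀ (L : Type) [Field L] [NumberField L] [Algebra (CyclotomicField 3 ℚ) L]
      (s : L) (c : L ≃ₐ[ℚ] L)
      (hcptL : isCompact_glFiniteIntegralLevel 3 L) (S_L : Finset (HeightOneSpectrum (𝓞 L))),
      NumberField.IsCMField L → c₀ ≠ 1 → s ^ 2 = -2 → Module.finrank (CyclotomicField 3 ℚ) L = 2 →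
      c s = -s →
      (∀ x : CyclotomicField 3 ℚ,
        c (algebraMap (CyclotomicField 3 ℚ) L x) = algebraMap (CyclotomicField 3 ℚ) L (c₀ x)) →
      FramedRep.IsAbsolutelyIrreducible (ρ.restrictField L) →
      (∀ w : HeightOneSpectrum (𝓞 L), ((3 : ℕ) : 𝓞 L) ∈ w.asIdeal → w ∈ S_L) →
      (∀ w : HeightOneSpectrum (𝓞 L), w.under (𝓞 (CyclotomicField 3 ℚ)) ∈ S₀ → w ∈ S_L) →
      (∀ k : ℕ, ∃ (P : CuspidalAutomorphicRepData 3 L hcptL)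
        (r : FramedGaloisRep L (PadicAlgCl 3) 3),
        P.1.IsRegularAlgebraic ∧ P.1.IsConjSelfDualAE c ∧
        (∀ w ∉ S_L, P.1.IsUnramifiedAt w ∧ IsGaloisCompatibleAt P.1 ι r w) ∧
        ∀ g : Field.absoluteGaloisGroup L,
          ‖FramedRep.trace r g - FramedRep.trace (ρ.restrictField L) g‖ ≤ ((3 : ℝ)⁻¹) ^ k) →
    ∃ (π' : CuspidalAutomorphicRepData 3 (CyclotomicField 3 ℚ) hcpt)
      (S' : Finset (HeightOneSpectrum (𝓞 (CyclotomicField 3 ℚ)))),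
      π'.1.IsLAlgebraic ∧
      ∀ 𝔭 ∉ S', ∃ α : Multiset ℂ, π'.1.HasSatakeParamAt 𝔭 α ∧
        ρ.IsUnramifiedAt 𝔭 ∧ ρ.HasFrobCharpolyAt 𝔭 (arithFrobPolyOfSatake ι 𝔭.residueCard 1 α)

/-- The heart of reshape r5 (`stub_twoWallOrdinaryClassicality`, VERBATIM): the same without `art`
and without the `K`-side ordinary avatars. -/
def TwoWallOrdinaryClassicalityStmt : Prop :=
    ∀ (f : ℤ[X]) (hcpt : isCompact_glFiniteIntegralLevel 3 (CyclotomicField 3 ℚ)),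
      f.natDegree = 4 → (f.map (Int.castRingHom ℚ)).Separable →
      12 ∣ Nat.card (f.map (Int.castRingHom ℚ)).Gal →
    ∀ (ι : PadicAlgCl 3 ≃+* ℂ) (e : CyclotomicField 3 ℚ →+* ℂ)
      (S₀ : Finset (HeightOneSpectrum (𝓞 (CyclotomicField 3 ℚ))))
      (ϖ : HeightOneSpectrum (𝓞 (CyclotomicField 3 ℚ)) → 𝓞 (CyclotomicField 3 ℚ))
      (ρ : FramedGaloisRep (CyclotomicField 3 ℚ) (PadicAlgCl 3) 3),
      (∀ v : HeightOneSpectrum (𝓞 (CyclotomicField 3 ℚ)),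
        ((3 : ℕ) : 𝓞 (CyclotomicField 3 ℚ)) ∈ v.asIdeal → v ∈ S₀) →
      (∀ 𝔭 ∉ S₀,
        (𝔭.asIdeal = Ideal.span {ϖ 𝔭} ∧
          ϖ 𝔭 - 1 ∈ Ideal.span {(3 : 𝓞 (CyclotomicField 3 ℚ))}) ∧
        ρ.IsUnramifiedAt 𝔭 ∧
        ∀ 𝔓 ∈ 𝔭.primesAbove, ∀ τ : Field.absoluteGaloisGroup (CyclotomicField 3 ℚ),
          IsArithFrobAt (𝓞 (CyclotomicField 3 ℚ)) τ 𝔓 →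
            FramedRep.trace ρ τ⁻¹ = ι.symm (e (↑(picardTrace f 𝔭 * ϖ 𝔭)))) →
    ∀ (L : Type) [Field L] [NumberField L] [Algebra (CyclotomicField 3 ℚ) L]
      (s : L) (c : L ≃ₐ[ℚ] L) (c₀ : CyclotomicField 3 ℚ ≃ₐ[ℚ] CyclotomicField 3 ℚ)
      (hcptL : isCompact_glFiniteIntegralLevel 3 L) (S_L : Finset (HeightOneSpectrum (𝓞 L))),
      NumberField.IsCMField L → c₀ ≠ 1 → s ^ 2 = -2 → Module.finrank (CyclotomicField 3 ℚ) L = 2 →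
      c s = -s →
      (∀ x : CyclotomicField 3 ℚ,
        c (algebraMap (CyclotomicField 3 ℚ) L x) = algebraMap (CyclotomicField 3 ℚ) L (c₀ x)) →
      FramedRep.IsAbsolutelyIrreducible (ρ.restrictField L) →
      (∀ w : HeightOneSpectrum (𝓞 L), ((3 : ℕ) : 𝓞 L) ∈ w.asIdeal → w ∈ S_L) →
      (∀ w : HeightOneSpectrum (𝓞 L), w.under (𝓞 (CyclotomicField 3 ℚ)) ∈ S₀ → w ∈ S_L) →
      (∀ k : ℕ, ∃ (P : CuspidalAutomorphicRepData 3 L hcptL)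
        (r : FramedGaloisRep L (PadicAlgCl 3) 3),
        P.1.IsRegularAlgebraic ∧ P.1.IsConjSelfDualAE c ∧
        (∀ w ∉ S_L, P.1.IsUnramifiedAt w ∧ IsGaloisCompatibleAt P.1 ι r w) ∧
        ∀ g : Field.absoluteGaloisGroup L,
          ‖FramedRep.trace r g - FramedRep.trace (ρ.restrictField L) g‖ ≤ ((3 : ℝ)⁻¹) ^ k) →
    ∃ (π' : CuspidalAutomorphicRepData 3 (CyclotomicField 3 ℚ) hcpt)
      (S' : Finset (HeightOneSpectrum (𝓞 (CyclotomicField 3 ℚ)))),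
      π'.1.IsLAlgebraic ∧
      ∀ 𝔭 ∉ S', ∃ α : Multiset ℂ, π'.1.HasSatakeParamAt 𝔭 α ∧
        ρ.IsUnramifiedAt 𝔭 ∧ ρ.HasFrobCharpolyAt 𝔭 (arithFrobPolyOfSatake ι 𝔭.residueCard 1 α)

/-- The honest heart is WEAKER than the registered one (more hypotheses): the registered heart implies
it by forgetting `art` and the avatars. [folklore] -/
theorem twoWallOrd_of_twoWall (h : TwoWallOrdinaryClassicalityStmt) : TwoWallOrdinaryClassicalityOrdStmt :=
  fun _ f hcpt hdeg hsep hgal ι e S₀ ϖ ρ hS₀ hρ c₀ _ _ L _ _ _ s c hcptL S_L hCM hc₀ hs hdegL hcs hcc₀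
    hirr hSL3 hSLS₀ htowerL =>
    h f hcpt hdeg hsep hgal ι e S₀ ϖ ρ hS₀ hρ L s c c₀ hcptL S_L hCM hc₀ hs hdegL hcs hcc₀ hirr hSL3
      hSLS₀ htowerL

/-- **The heart, LINKED form** (reshape r9 of lead c3 — the registered
`stub_twoWallOrdinaryClassicalityOrd` v2 VERBATIM): as `TwoWallOrdinaryClassicalityOrdStmt`, but the
anonymous `L`-side tower is replaced by the base-change MAP of the landed `stub_baseChangeToL_linked` —
for every depth `k` and every member `(P, r)` in the `K`-side currency an unramified strong base-change
lift `P_L` (`IsUnramifiedBaseChangeLift P P_L`), regular algebraic `c`-conjugate-self-dual cuspidal,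
Galois-compatible with `r|_{Γ_L}` off `S_L`, with the trace bound on `Γ_L` — plus `S₀ ⊆ S_K` and `S_L ⊇ {w ∣ S_K}`.
WEAKER than the unlinked form (`twoWallLinked_of_twoWallOrd`); same conclusion, same truth status
(implied by reciprocity for `ρ'_C`); the statement to promote.  (`λ` splits in `L`, i.e. `L_u = K_λ`,
follows from `[L : K] = 2`, `s² = -2`: landed lemma `lambda_splits_of_sq_eq_neg_two`.) -/
def TwoWallOrdinaryClassicalityLinkedStmt : Prop :=
    ∀ (art : ArtinData) (f : ℤ[X]) (hcpt : isCompact_glFiniteIntegralLevel 3 (CyclotomicField 3 ℚ)),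
      f.natDegree = 4 → (f.map (Int.castRingHom ℚ)).Separable →
      12 ∣ Nat.card (f.map (Int.castRingHom ℚ)).Gal →
    ∀ (ι : PadicAlgCl 3 ≃+* ℂ) (e : CyclotomicField 3 ℚ →+* ℂ)
      (S₀ : Finset (HeightOneSpectrum (𝓞 (CyclotomicField 3 ℚ))))
      (ϖ : HeightOneSpectrum (𝓞 (CyclotomicField 3 ℚ)) → 𝓞 (CyclotomicField 3 ℚ))
      (ρ : FramedGaloisRep (CyclotomicField 3 ℚ) (PadicAlgCl 3) 3),
      (∀ v : HeightOneSpectrum (𝓞 (CyclotomicField 3 ℚ)),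
        ((3 : ℕ) : 𝓞 (CyclotomicField 3 ℚ)) ∈ v.asIdeal → v ∈ S₀) →
      (∀ 𝔭 ∉ S₀,
        (𝔭.asIdeal = Ideal.span {ϖ 𝔭} ∧
          ϖ 𝔭 - 1 ∈ Ideal.span {(3 : 𝓞 (CyclotomicField 3 ℚ))}) ∧
        ρ.IsUnramifiedAt 𝔭 ∧
        ∀ 𝔓 ∈ 𝔭.primesAbove, ∀ τ : Field.absoluteGaloisGroup (CyclotomicField 3 ℚ),
          IsArithFrobAt (𝓞 (CyclotomicField 3 ℚ)) τ 𝔓 →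
            FramedRep.trace ρ τ⁻¹ = ι.symm (e (↑(picardTrace f 𝔭 * ϖ 𝔭)))) →
    ∀ (c₀ : CyclotomicField 3 ℚ ≃ₐ[ℚ] CyclotomicField 3 ℚ)
      (S_K : Finset (HeightOneSpectrum (𝓞 (CyclotomicField 3 ℚ)))),
      OrdPolarizedTower art hcpt ι c₀ S_K (fun 𝔭 => e (↑(picardTrace f 𝔭 * ϖ 𝔭))) → S₀ ⊆ S_K →
    ∀ (L : Type) [Field L] [NumberField L] [Algebra (CyclotomicField 3 ℚ) L]
      (s : L) (c : L ≃ₐ[ℚ] L)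
      (hcptL : isCompact_glFiniteIntegralLevel 3 L) (S_L : Finset (HeightOneSpectrum (𝓞 L))),
      NumberField.IsCMField L → c₀ ≠ 1 → s ^ 2 = -2 → Module.finrank (CyclotomicField 3 ℚ) L = 2 →
      c s = -s →
      (∀ x : CyclotomicField 3 ℚ,
        c (algebraMap (CyclotomicField 3 ℚ) L x) = algebraMap (CyclotomicField 3 ℚ) L (c₀ x)) →
      FramedRep.IsAbsolutelyIrreducible (ρ.restrictField L) →
      (∀ w : HeightOneSpectrum (𝓞 L), ((3 : ℕ) : 𝓞 L) ∈ w.asIdeal → w ∈ S_L) →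
      (∀ w : HeightOneSpectrum (𝓞 L), w.under (𝓞 (CyclotomicField 3 ℚ)) ∈ S₀ → w ∈ S_L) →
      (∀ w : HeightOneSpectrum (𝓞 L), w.under (𝓞 (CyclotomicField 3 ℚ)) ∈ S_K → w ∈ S_L) →
      (∀ (k : ℕ) (P : CuspidalAutomorphicRepData 3 (CyclotomicField 3 ℚ) hcpt)
        (r : FramedGaloisRep (CyclotomicField 3 ℚ) (PadicAlgCl 3) 3),
        P.1.IsRegularAlgebraic → P.1.IsConjSelfDualAE c₀ →
        (∀ 𝔭 ∉ S_K, IsGaloisCompatibleAt P.1 ι r 𝔭 ∧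
          ∃ (α : Multiset ℂ) (t : integralClosure ℤ ℂ), P.1.HasSatakeParamAt 𝔭 α ∧
            (t : ℂ) = (𝔭.residueCard : ℂ) * α.sum - e (↑(picardTrace f 𝔭 * ϖ 𝔭)) ∧
            ‖ι.symm (t : ℂ)‖ ≤ ((3 : ℝ)⁻¹) ^ k) →
        ∃ P_L : CuspidalAutomorphicRepData 3 L hcptL,
          P_L.1.IsRegularAlgebraic ∧ P_L.1.IsConjSelfDualAE c ∧
          IsUnramifiedBaseChangeLift P.1 P_L.1 ∧
          (∀ w ∉ S_L, P_L.1.IsUnramifiedAt w ∧ IsGaloisCompatibleAt P_L.1 ι (r.restrictField L) w) ∧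
          ∀ g : Field.absoluteGaloisGroup L,
            ‖FramedRep.trace (r.restrictField L) g - FramedRep.trace (ρ.restrictField L) g‖ ≤
              ((3 : ℝ)⁻¹) ^ k) →
    ∃ (π' : CuspidalAutomorphicRepData 3 (CyclotomicField 3 ℚ) hcpt)
      (S' : Finset (HeightOneSpectrum (𝓞 (CyclotomicField 3 ℚ)))),
      π'.1.IsLAlgebraic ∧
      ∀ 𝔭 ∉ S', ∃ α : Multiset ℂ, π'.1.HasSatakeParamAt 𝔭 α ∧
        ρ.IsUnramifiedAt 𝔭 ∧ ρ.HasFrobCharpolyAt 𝔭 (arithFrobPolyOfSatake ι 𝔭.residueCard 1 α)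

/-- **The linked heart is WEAKER than the unlinked one**: apply the base-change map to the members of
the ordinary tower to obtain the anonymous `L`-side tower, then the unlinked heart. [folklore] -/
theorem twoWallLinked_of_twoWallOrd (h : TwoWallOrdinaryClassicalityOrdStmt) :
    TwoWallOrdinaryClassicalityLinkedStmt := by
  intro art f hcpt hdeg hsep hgal ι e S₀ ϖ ρ hS₀ hρ c₀ S_K hord _ L _ _ _ s c hcptL S_L hCM hc₀ hs hdegL
    hcs hcc₀ hirr hSL3 hSLS₀ _ hmap
  refine h art f hcpt hdeg hsep hgal ι e S₀ ϖ ρ hS₀ hρ c₀ S_K hord L s c hcptL S_L hCM hc₀ hs hdegL hcs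
    hcc₀ hirr hSL3 hSLS₀ fun k => ?_
  obtain ⟨P, r, hreg, hcsd, hP, -⟩ := hord k
  obtain ⟨P_L, hregL, hcsdL, -, hcompL, htr⟩ :=
    hmap k P r hreg hcsd fun 𝔭 h𝔭 => ⟨(hP 𝔭 h𝔭).2.1, (hP 𝔭 h𝔭).2.2⟩
  exact ⟨P_L, r.restrictField L, hregL, hcsdL, hcompL, htr⟩

/-- **THE CERTIFICATE** (reshape r8 form, lead c3, 2026-08-16: Harris–Lan–Taylor–Thorne dropped).
The landed stubs close the ORDINARY restated crux modulo (a) the Picard named fact, (b) the THREE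
Arthur–Clozel base-change facts, (c) the honest heart — nothing else: no interface stub, no remainder
stub, no `exists_galoisRep_of_regularAlgebraic`.  Proof: unpack `(e, ι, S, c₀, ϖ, (Π_k, r_k))`; Stub 2
(landed, conditional on (a)) gives `S₀ ⊇ {v ∣ 3}`, primary generators `ϖ'` off `S₀` and `ρ = ρ_C ⊗ ψ`
read through `(ι, e)`; by `primaryGen_unique` (landed) `ϖ = ϖ'` off `S ∪ S₀`, so the given tower is an
ordinary polarized tower for the trace function of `ρ` off `S ∪ S₀`; Stub 4 in LINKED form
(`stub_baseChangeToL_linked`, landed r9, conditional on (b)) supplies `L = K(√-2)`, `S_L` and the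
base-change map on members (no place dictionary, no HLTT); the LINKED heart (c) — fed the `K`-side
ordinary tower and the map — makes `ρ` automorphic over `K`; Stub 6 (landed, unconditional) untwists in
sum form.  Corollary `irregularClassicalityOrd_of_ord`: the same with c1's unlinked heart. [folklore] -/
theorem irregularClassicalityOrd_of
    (hPic : Literature.NumberTheory.GaloisRepresentations.picardCurve_exists_lambdaAdicRep)
    (hBCc : baseChange_cyclic_cuspidal) (hBCu : ArthurClozel1989_strongLifting_unramified)
    (hBCa : ArthurClozel1989_strongLifting_archimedean)
    (hHeart : TwoWallOrdinaryClassicalityLinkedStmt) :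
    IrregularClassicalityOrd := by
  intro art f hcpt hdeg hsep hgal hyp
  classical
  obtain ⟨e, ι, S, c₀, ϖ, hc₀, hϖ, htower⟩ := hyp
  -- Stub 2 (landed, conditional on the Picard named fact): S₀, primary generators ϖ', ρ = ρ_C ⊗ ψ
  obtain ⟨S₀, ϖ', ρ, hS₀, hirr, hρ⟩ :=
    Summit.Langlands.Langlands.Theorems.IrregularClassicality.SplitRamifiedPrimeSqrt6.stub_twistedPicardGaloisInput
      hPic f hdeg hsep hgal ι e
  -- primary generators agree off `S ∪ S₀`
  have hϖeq : ∀ 𝔭, 𝔭 ∉ S ∪ S₀ → ϖ 𝔭 = ϖ' 𝔭 := by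
    intro 𝔭 h𝔭
    simp only [Finset.mem_union, not_or] at h𝔭
    have h𝔭3 : (3 : 𝓞 (CyclotomicField 3 ℚ)) ∉ 𝔭.asIdeal := fun h =>
      h𝔭.2 (hS₀ 𝔭 (by rwa [Nat.cast_ofNat]))
    exact Summit.Langlands.Langlands.Theorems.IrregularClassicality.SplitRamifiedPrimeSqrt6.primaryGen_unique
      h𝔭3 (hϖ 𝔭 h𝔭.1).1 (hρ 𝔭 h𝔭.2).1.1 (hϖ 𝔭 h𝔭.1).2 (hρ 𝔭 h𝔭.2).1.2
  -- the given tower, read off `S ∪ S₀`, is an ORDINARY polarized tower for the trace function of ρ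
  have havat : OrdPolarizedTower art hcpt ι c₀ (S ∪ S₀) (fun 𝔭 => e (↑(picardTrace f 𝔭 * ϖ' 𝔭))) := by
    intro k
    obtain ⟨P, r, hreg, hcsd, hP, hord⟩ := htower k
    refine ⟨P, r, hreg, hcsd, fun 𝔭 h𝔭 => ?_, hord⟩
    have h𝔭S : 𝔭 ∉ S := fun h => h𝔭 (Finset.mem_union_left _ h)
    obtain ⟨hunr, hcomp, α, t, hα, ht, hnorm⟩ := hP 𝔭 h𝔭S
    refine ⟨hunr, hcomp, α, t, hα, ?_, hnorm⟩
    dsimp only at ht ⊢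
    rw [← hϖeq 𝔭 h𝔭]
    exact ht
  -- Stub 4 in linked form (landed r9, conditional on the three Arthur–Clozel facts): L, S_L, the map
  obtain ⟨L, _instF, _instNF, _instA, s, c, hcptL, S_L, hCM, hs, hdegL, hcs, hcc₀, hSL3, hSLS₀, hSLS,
      hmap⟩ :=
    Summit.Langlands.Langlands.Theorems.IrregularClassicality.SplitRamifiedPrimeSqrt6.stub_baseChangeToL_linked
      hBCc hBCu hBCa ι hcpt c₀ hc₀ (S ∪ S₀) S₀
      (fun 𝔭 => e (↑(picardTrace f 𝔭 * ϖ' 𝔭))) ρ hS₀ (fun 𝔭 h𝔭 => (hρ 𝔭 h𝔭).2)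
  -- the linked heart, fed the K-side ordinary tower and the base-change map: ρ is automorphic over K
  obtain ⟨π', S'', hLalg, hcompat⟩ :=
    hHeart art f hcpt hdeg hsep hgal ι e S₀ ϖ' ρ hS₀ hρ c₀ (S ∪ S₀) havat Finset.subset_union_right L s c
      hcptL S_L hCM hc₀ hs hdegL hcs hcc₀ (hirr L hdegL) hSL3 hSLS₀ hSLS hmap
  -- Stub 6 (landed, unconditional): untwist, in sum form
  obtain ⟨πK, hKalg, hev⟩ :=
    Summit.Langlands.Langlands.Theorems.IrregularClassicality.SplitRamifiedPrimeSqrt6.stub_irregularDescentUntwist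
      f hcpt hdeg hsep hgal ι e S₀ ϖ' ρ hS₀ hρ π' S'' hLalg hcompat
  exact ⟨e, πK, hKalg, hev⟩

/-- The certificate with c1's UNLINKED heart (continuity with the pre-r9 form). [folklore] -/
theorem irregularClassicalityOrd_of_ord
    (hPic : Literature.NumberTheory.GaloisRepresentations.picardCurve_exists_lambdaAdicRep)
    (hBCc : baseChange_cyclic_cuspidal) (hBCu : ArthurClozel1989_strongLifting_unramified)
    (hBCa : ArthurClozel1989_strongLifting_archimedean)
    (hHeart : TwoWallOrdinaryClassicalityOrdStmt) :
    IrregularClassicalityOrd :=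
  irregularClassicalityOrd_of hPic hBCc hBCu hBCa (twoWallLinked_of_twoWallOrd hHeart)

end Summit.Langlands.Langlands.Cruxes.IrregularClassicality.SplitRamifiedPrimeSqrt6.RestatedOrd

end
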